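import Literature.NumberTheory.Automorphic.BrandtModuleEisensteinCuspidalHecke
import HarnessLib

/-!
# Route `RamifiedHeegnerPair`, crux U₁ `LeafRankOneUpperAtThree` (stmt-BirchSwinnertonDyer-26022), line `partnerdescent` —
# input (C4) of the (G3♭ˢ) derivation: the EXACT Eisenstein property of the Brandt component group, reduced to one divisibility

HONEST FRAMING. Theorems only; helper file (`--supports stmt-BirchSwinnertonDyer-26022 --as helper`); elementary linear algebra over
the tree's Brandt-module vocabulary (`Brandt.XiSetup`, `Brandt.matrix`, `Brandt.weight`, `XiSetup.degree`;
`BrandtModuleEisensteinCuspidalHecke.lean`); no named fact, no `sorry`; nothing booked; BSD is proved for no curve. Lead prover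
bsd-line-rhp-p2 g61, 2026-08-31 (memo `Cruxes/LeafRankOneUpperAtThree/LEAD-G61-G3-CORE.md` §7).

WHY. Step 1 of the (G3♭ˢ) derivation (LEAD-G56-G3-NONSCALAR.md) needs Grothendieck's pairing on `B_𝔪 = X_q(J_0(qrM))_𝔪` to be PERFECT
at the non-Eisenstein `𝔪 ∋ 3`, i.e. `Φ_𝔪 = 0` for `Φ = B^∨/B` — which follows from «`Φ` is Eisenstein: `T_ℓ − (ℓ + 1)` kills `Φ` for every
prime `ℓ ∤ N`» (Ribet). In the dictionary `X_q(J_0(qrM)) = ℤ[Cls O]⁰` (Brandt setup of type `(rM, q)`, Gross's pairing `⟨e_i, e_j⟩ = w_i δ_ij`)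
the tree so far has only the NAIVE bound with the factor `12 = lcm(w_c)` (`eisenstein12_of_brandtDictionary`,
`Brandt.XiSetup.dvd_twelve_mul_sub_of_forall_dvd`), useless at the prime `3 ∣ 12`. This file proves the EXACT property in coordinates
from ONE elementary divisibility, for `n ≥ 1` prime to `N⁺N⁻`:

  (DIV)  `w_k ∣ T(n)_{ik}` for all classes `i ≠ k`

(for `n = ℓ` prime: the group `O_L(I_k)^×/±1`, of order `w_k`, acts FREELY on the sub-ideals `J = αI_i ⊂ I_k` of index `ℓ²` with `[I_i] ≠ [I_k]`
counted by `T(ℓ)_{ik}` — a fixed sub-ideal would be `πI_k` for a norm-`ℓ` element `π` of `ℤ[u] ⊂ O_L(I_k)`, forcing `[I_i] = [I_k]`; memo §7;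
NOT proved here, taken as the hypothesis `hdiv`). Given (DIV):

* `mulVec_sub_sigma_integral_of_weight_dvd` — for every `x ∈ ℚ^{Cls}` whose weighted coordinates `w_c x_c` are congruent to each other
  modulo `ℤ` (this is `x ∈ M^∨ + ℚ·e₀`, `e₀ = (1/w_c)_c` Gross's Eisenstein vector; it contains the dual lattice `B^∨` of `B = ℤ[Cls]⁰`),
  the vector `T(n)x − σ₁(n)x` is INTEGRAL. Proof: `x_k = (w_i x_i + m_k)/w_k` with `m_k ∈ ℤ`, `m_i = 0`; the `w_i x_i`-part is killed by
  the Eisenstein eigen-relation `Σ_k T_{ik}/w_k = σ₁(n)/w_i` (tree `XiSetup.toLin_matrix_inv_weight`, from weight symmetry and column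
  sums), and what is left is `Σ_{k ≠ i} (T_{ik}/w_k) m_k ∈ ℤ` by (DIV).
* `exact_eisenstein_of_weight_dvd` — **`(T(n) − σ₁(n))·B^∨ ⊆ B`**: for `x` of degree `0` pairing integrally with every integral vector of
  degree `0` (`x ∈ B^∨`), `T(n)x − σ₁(n)x` is integral of degree `0` (`∈ B`). So `Φ = B^∨/B` is EXACTLY Eisenstein and `Φ_𝔪 = 0` at every
  non-Eisenstein `𝔪`, residue characteristic `3` included.

[cite: Gross1987, §1–§2 (`e₀`, `deg t_m = σ(m)`, `⟨e_i,e_j⟩ = w_i δ_ij`)] [cite: Ribet1990, Prop. 3.1–3.2 and Thm. 3.12 (the component group of `J_0(qM)` at `q` is Eisenstein)]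
[cite: Eichler1973, Ch. II §6 Thm. 2 (17) (weight symmetry)]
-/

set_option linter.dupNamespace false
set_option autoImplicit false

noncomputable section

open ArithmeticFunction

namespace Summit.BirchSwinnertonDyer.BirchSwinnertonDyer.Theorems.LeafPartnerBrandt

open Literature.NumberTheory.Automorphic Literature.NumberTheory.Automorphic.Brandt

variable {Nplus Nminus : ℕ} (S : XiSetup Nplus Nminus) [Fintype (ClassSet S.O)] [DecidableEq (ClassSet S.O)]

/-- **Exact Eisenstein from (DIV), vector form.** Let `n ≥ 1` be prime to `N⁺N⁻` and assume (DIV) `w_k ∣ T(n)_{ik}` for `i ≠ k`. If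
`x ∈ ℚ^{Cls O}` has all `w_i x_i − w_k x_k ∈ ℤ`, then `T(n)x − σ₁(n)x ∈ ℤ^{Cls O}`. [cite: Gross1987, §1–§2] [cite: Ribet1990, Thm. 3.12] -/
theorem mulVec_sub_sigma_integral_of_weight_dvd {n : ℕ} (hn : n ≠ 0) (hcop : Nat.Coprime n (Nplus * Nminus))
    (hdiv : ∀ i k : ClassSet S.O, i ≠ k → (weight S.O k : ℤ) ∣ matrix S.O n i k)
    (x : ClassSet S.O → ℚ)
    (hx : ∀ i k : ClassSet S.O, ∃ m : ℤ, (weight S.O i : ℚ) * x i - (weight S.O k : ℚ) * x k = m) (i : ClassSet S.O) :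
    ∃ m : ℤ, (Matrix.toLin' ((matrix S.O n).map (Int.cast : ℤ → ℚ)) x - ((sigma 1 n : ℕ) : ℚ) • x) i = m := by
  have hw : ∀ c : ClassSet S.O, (weight S.O c : ℚ) ≠ 0 := fun c =>
    Nat.cast_ne_zero.mpr (Nat.one_le_iff_ne_zero.mp (S.one_le_weight c))
  -- the integers `m_k := w_k x_k − w_i x_i`
  choose m hm using fun k => hx k i
  -- the integers `d_k := T_{ik} / w_k` for `k ≠ i` (and `0` at `k = i`)
  have hd' : ∀ k, ∃ d : ℤ, k ≠ i → matrix S.O n i k = (weight S.O k : ℤ) * d := by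
    intro k
    by_cases hk : k = i
    · exact ⟨0, fun h => absurd hk h⟩
    · obtain ⟨d, hd⟩ := hdiv i k (Ne.symm hk)
      exact ⟨d, fun _ => hd⟩
  choose d hd using hd'
  refine ⟨∑ k, if k = i then 0 else d k * m k, ?_⟩
  -- the Eisenstein eigen-relation at `i`: `Σ_k T_{ik} / w_k = σ₁(n) / w_i`
  have hE := congrFun (S.toLin_matrix_inv_weight hn hcop) i
  rw [Matrix.toLin'_apply, Pi.smul_apply, smul_eq_mul, Matrix.mulVec, dotProduct] at hE
  rw [Pi.sub_apply, Matrix.toLin'_apply, Pi.smul_apply, smul_eq_mul, Matrix.mulVec, dotProduct]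
  -- rewrite each summand: `T_{ik} x_k = (T_{ik}/w_k)·(w_i x_i) + [k ≠ i]·d_k m_k`
  have key : ∀ k, (matrix S.O n).map (Int.cast : ℤ → ℚ) i k * x k
      = (matrix S.O n).map (Int.cast : ℤ → ℚ) i k * ((weight S.O k : ℚ))⁻¹ * ((weight S.O i : ℚ) * x i)
        + (if k = i then 0 else ((d k * m k : ℤ) : ℚ)) := by
    intro k
    have hmk : (weight S.O k : ℚ) * x k = (weight S.O i : ℚ) * x i + m k := by
      have := hm k; linarith
    have hxk : x k = ((weight S.O k : ℚ))⁻¹ * ((weight S.O i : ℚ) * x i + m k) := by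
      rw [← hmk, ← mul_assoc, inv_mul_cancel₀ (hw k), one_mul]
    by_cases hk : k = i
    · subst hk
      rw [if_pos rfl, add_zero, mul_assoc, inv_mul_cancel_left₀ (hw k)]
    · have hwk : (weight S.O k : ℚ) ≠ 0 := hw k
      rw [if_neg hk, hxk, Matrix.map_apply, hd k hk]
      push_cast
      field_simp
  rw [Finset.sum_congr rfl (fun k _ => key k), Finset.sum_add_distrib, ← Finset.sum_mul, hE]
  push_cast
  rw [mul_assoc, inv_mul_cancel_left₀ (hw i)]
  ring

/-- **`(T(n) − σ₁(n))·B^∨ ⊆ B`: the component group `Φ = B^∨/B` of the degree-zero Brandt lattice `B = ℤ[Cls O]⁰` (Gross's pairing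
`⟨e_i,e_j⟩ = w_i δ_ij`) is EXACTLY Eisenstein**, granted (DIV). Here `x ∈ B^∨` is spelled: `deg x = 0` and `Σ_c w_c x_c b_c ∈ ℤ` for every
`b ∈ ℤ^{Cls O}` of degree `0`; the conclusion: `T(n)x − σ₁(n)x` is integral and of degree `0`. In the (G3♭ˢ) derivation this gives the
perfectness of the monodromy pairing on `B_𝔪` at a non-Eisenstein `𝔪` of residue characteristic `3` (input (C4)).
[cite: Ribet1990, Prop. 3.1–3.2, Thm. 3.12] [cite: Gross1987, §1–§2] -/
theorem exact_eisenstein_of_weight_dvd {n : ℕ} (hn : n ≠ 0) (hcop : Nat.Coprime n (Nplus * Nminus))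
    (hdiv : ∀ i k : ClassSet S.O, i ≠ k → (weight S.O k : ℤ) ∣ matrix S.O n i k)
    (x : ClassSet S.O → ℚ) (hdeg : S.degree x = 0)
    (hdual : ∀ b : ClassSet S.O → ℤ, ∑ c, b c = 0 → ∃ m : ℤ, ∑ c, (weight S.O c : ℚ) * x c * (b c : ℚ) = m) :
    (∀ i, ∃ m : ℤ, (Matrix.toLin' ((matrix S.O n).map (Int.cast : ℤ → ℚ)) x - ((sigma 1 n : ℕ) : ℚ) • x) i = m) ∧
      S.degree (Matrix.toLin' ((matrix S.O n).map (Int.cast : ℤ → ℚ)) x - ((sigma 1 n : ℕ) : ℚ) • x) = 0 := by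
  refine ⟨mulVec_sub_sigma_integral_of_weight_dvd S hn hcop hdiv x (fun i k => ?_), ?_⟩
  · -- pair with the degree-zero vector `b = e_i − e_k`
    by_cases hik : i = k
    · subst hik; exact ⟨0, by simp⟩
    obtain ⟨m, hm⟩ := hdual (Pi.single i 1 - Pi.single k 1) (by
      simp only [Pi.sub_apply, Finset.sum_sub_distrib, Finset.sum_pi_single', Finset.mem_univ, if_true, sub_self])
    refine ⟨m, ?_⟩
    rw [← hm]
    simp only [Pi.sub_apply, Int.cast_sub, mul_sub, Finset.sum_sub_distrib]
    rw [Finset.sum_eq_single i (fun c _ hc => by simp [hc]) (fun h => absurd (Finset.mem_univ i) h),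
      Finset.sum_eq_single k (fun c _ hc => by simp [hc]) (fun h => absurd (Finset.mem_univ k) h)]
    simp
  · rw [map_sub, map_smul, S.degree_toLin_matrix hn hcop, hdeg]
    simp

/-! ## Appended (same seat, lead g61): the EXACT integral Eisenstein divisibility `d ∣ λ(ℓ) − (ℓ + 1)` from (DIV)

The exact analogue of the tree's `dvd_mul_sub_of_forall_dvd_sub` ∕ `Brandt.XiSetup.dvd_twelve_mul_sub_of_forall_dvd`
(`…RibetTakahashiPairwiseEisensteinProofs`), which carry the factor `K = 12`: with (DIV) in place of `w_c ∣ K` the factor disappears.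
For `g = g_r` (generator of the `f`-line, unimodular) and `d = i_r` (Takahashi's image order, which divides every Gross pairing
`⟨g, e_c − e_{c'}⟩ = w_c g_c − w_{c'} g_{c'}`) this is Ribet's Eisenstein theorem `i_r ∣ a_ℓ − ℓ − 1` in coordinates — the EXACT shape `hEis`
∕ `ComponentOrders.ImageEisenstein` of Pasten's Lemma 6.14, at every prime including `3`. -/

section Integral

variable {ι : Type*} [Fintype ι] [DecidableEq ι]

/-- **`d ∣ λ − s`, exactly.** Let `T` be an integer matrix with weight symmetry `w_i T_{ij} = w_j T_{ji}` (`w_i ≠ 0`), column sums `s`,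
and (DIV) `w_k ∣ T_{ik}` for `i ≠ k`; let `v` be an eigenvector `T v = λ v` on which some integral functional takes the value `1`, and `d` an
integer dividing every `w_i v_i − w_j v_j`. Then `d ∣ λ − s`. Proof: for each `i`, with `T_{ik} = w_k e_{ik}` (`k ≠ i`) and hence
`T_{ki} = w_i e_{ik}`: `(λ − s) v_i = Σ_{k ≠ i} e_{ik} (w_k v_k − w_i v_i)`. [cite: Gross1987, §2 (Eisenstein vector)] [cite: Ribet1990, Thm. 3.12] -/
theorem dvd_sub_of_forall_dvd_sub_of_weight_dvd (T : Matrix ι ι ℤ) (w : ι → ℤ) {lam s : ℤ} {v : ι → ℤ}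
    (hsymm : ∀ i j, w i * T i j = w j * T j i) (hcol : ∀ j, ∑ i, T i j = s) (hv : T.mulVec v = lam • v)
    (hw : ∀ i, w i ≠ 0) (hdiv : ∀ i k, i ≠ k → w k ∣ T i k)
    {d : ℤ} (hcong : ∀ i j, d ∣ w i * v i - w j * v j) {t : ι → ℤ} (ht : ∑ i, t i * v i = 1) :
    d ∣ lam - s := by
  -- `e i k := T_{ik} / w_k` for `k ≠ i`, `0` at `k = i`
  have hd' : ∀ i k, ∃ e : ℤ, k ≠ i → T i k = w k * e := by
    intro i k
    by_cases hk : k = i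
    · exact ⟨0, fun h => absurd hk h⟩
    · obtain ⟨e, he⟩ := hdiv i k (Ne.symm hk)
      exact ⟨e, fun _ => he⟩
  choose e he using hd'
  -- the transposed entries: `T_{ki} = w_i e_{ik}` for `k ≠ i`
  have he' : ∀ i k, k ≠ i → T k i = w i * e i k := by
    intro i k hk
    have h := hsymm k i
    rw [he i k hk, mul_left_comm] at h
    exact mul_left_cancel₀ (hw k) h
  -- the identity `(λ − s) v_i = Σ_k [k ≠ i] e_{ik} (w_k v_k − w_i v_i)`
  have key : ∀ i, (lam - s) * v i = ∑ k, if k = i then 0 else e i k * (w k * v k - w i * v i) := by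
    intro i
    -- `Σ_k T_{ik} v_k = λ v_i`
    have h1 : ∑ k, T i k * v k = lam * v i := by
      have := congrFun hv i
      rwa [Matrix.mulVec, dotProduct, Pi.smul_apply, smul_eq_mul] at this
    -- `Σ_k T_{ki} = s`
    have h2 : ∑ k, T k i = s := hcol i
    -- split both sums at `k = i`
    rw [← Finset.add_sum_erase _ _ (Finset.mem_univ i)] at h1 h2
    have h3 : ∑ k ∈ Finset.univ.erase i, T i k * v k = ∑ k ∈ Finset.univ.erase i, e i k * (w k * v k) :=
      Finset.sum_congr rfl fun k hk => by rw [he i k (Finset.ne_of_mem_erase hk)]; ring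
    have h4 : ∑ k ∈ Finset.univ.erase i, T k i = ∑ k ∈ Finset.univ.erase i, w i * e i k :=
      Finset.sum_congr rfl fun k hk => he' i k (Finset.ne_of_mem_erase hk)
    rw [h3] at h1
    rw [h4] at h2
    rw [← Finset.add_sum_erase _ _ (Finset.mem_univ i), if_pos rfl, zero_add,
      Finset.sum_congr rfl fun k hk => if_neg (Finset.ne_of_mem_erase hk)]
    simp_rw [mul_sub, Finset.sum_sub_distrib]
    have h5 : ∑ k ∈ Finset.univ.erase i, e i k * (w i * v i) = (∑ k ∈ Finset.univ.erase i, w i * e i k) * v i := by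
      rw [Finset.sum_mul]; exact Finset.sum_congr rfl fun k _ => by ring
    rw [h5]
    linear_combination (-1 : ℤ) * h1 + v i * h2
  -- each `(λ − s) v_i` is divisible by `d`, hence so is `(λ − s) Σ t_i v_i = λ − s`
  have hdi : ∀ i, d ∣ (lam - s) * v i := fun i => by
    rw [key i]
    exact Finset.dvd_sum fun k _ => by
      by_cases hk : k = i
      · rw [if_pos hk]; exact dvd_zero d
      · rw [if_neg hk]; exact Dvd.dvd.mul_left (hcong k i) _
  have : lam - s = ∑ i, t i * ((lam - s) * v i) := by
    calc lam - s = (lam - s) * ∑ i, t i * v i := by rw [ht, mul_one]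
      _ = ∑ i, t i * ((lam - s) * v i) := by rw [Finset.mul_sum]; exact Finset.sum_congr rfl fun i _ => by ring
  rw [this]
  exact Finset.dvd_sum fun i _ => Dvd.dvd.mul_left (hdi i) _

end Integral

/-- **`d ∣ λ(ℓ) − (ℓ + 1)` in a Brandt setup, exactly, granted (DIV) at `ℓ`.** As the tree's
`Brandt.XiSetup.dvd_twelve_mul_sub_of_forall_dvd` without the factor `12`: `S` a Brandt setup of type `(N⁺, N⁻)`, `g` a common eigenvector of
the `T(ℓ)` (`ℓ ∤ N⁺N⁻`) with eigenvalues `λ(ℓ)`, unimodular in `ℤ^{Cls O}`, `d` dividing every `w_c g_c − w_{c'} g_{c'}`; if at the prime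
`ℓ ∤ N⁺N⁻` one has (DIV) `w_k ∣ T(ℓ)_{ik}` (`i ≠ k`), then `d ∣ λ(ℓ) − (ℓ + 1)`. For `g = g_r`, `d = i_r` (the dictionary `hDict`): the EXACT
Eisenstein divisibility `i_r ∣ a_ℓ − ℓ − 1` (Pasten Lemma 6.14's input, Ribet 1990 Thm. 3.12), valid at `3`.
[cite: Ribet1990, §3 Thm. 3.12] [cite: PastenShimura2024, Lemma 6.14 p. 23 (proof)] [cite: Eichler1973, Ch. II §6 Thm. 2 (17)] -/
theorem dvd_sub_of_eigenvector_of_weight_dvd {lam : ℕ → ℤ} {g : ClassSet S.O → ℤ}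
    (hg : g ∈ eigenLattice (Nplus * Nminus) (matrix S.O) lam)
    (hunimod : ∃ φ : Module.Dual ℤ (ClassSet S.O → ℤ), φ g = 1)
    {d : ℤ} (hcong : ∀ c c', d ∣ (weight S.O c : ℤ) * g c - (weight S.O c' : ℤ) * g c')
    {ℓ : ℕ} (hℓ : ℓ.Prime) (hℓN : ¬ ℓ ∣ Nplus * Nminus)
    (hdiv : ∀ i k : ClassSet S.O, i ≠ k → (weight S.O k : ℤ) ∣ matrix S.O ℓ i k) :
    d ∣ lam ℓ - (ℓ + 1) := by
  classical
  obtain ⟨φ, hφ⟩ := hunimod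
  have ht : ∑ c, φ (fun j => if c = j then (1 : ℤ) else 0) * g c = 1 := by
    have h := LinearMap.pi_apply_eq_sum_univ φ g
    rw [hφ] at h
    refine Eq.trans (Finset.sum_congr rfl fun c _ => ?_) h.symm
    rw [smul_eq_mul, mul_comm]
  have hw : ∀ c : ClassSet S.O, (weight S.O c : ℤ) ≠ 0 := fun c => by
    exact_mod_cast (Nat.one_le_iff_ne_zero.mp (S.one_le_weight c))
  exact dvd_sub_of_forall_dvd_sub_of_weight_dvd (matrix S.O ℓ) (fun c => (weight S.O c : ℤ))
    (fun i j => S.weight_mul_matrix_symm ℓ i j) (fun j => S.sum_matrix_prime_eq hℓ hℓN j)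
    (hg ℓ hℓ hℓN) hw hdiv hcong ht

end Summit.BirchSwinnertonDyer.BirchSwinnertonDyer.Theorems.LeafPartnerBrandt

end
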